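/-
Copyright (c) 2026 the pub-hodgecm-mathlib formalisation cell (harness21).  Prover seat hodgecm-mathlib-K2E4-p02 (g0), Track B ∕ K2-LIT
(build stream 29), h413 = `stmt-HodgeConjecture-24833`, line `K2_E4_SingularTransferKappaSign`, socket module «SplitDescent», file #2 — KIT (part 1 of 3).  2026-09-03.
-/
import Literature.NumberTheory.Rogawski1990.SmoothTransferSplitPlaceNamed               -- ★ `cmSplitTransfer`, `cmConstantTermSplit`, `splitKUMeasure`, the split frame (Lemma 4.13.1 (a) BY NAME)
import Literature.NumberTheory.Rogawski1990.AdelicStableOrbitalEulerDischargeSemisimple  -- ★ `coe_toLocal_toAdelic_eq_map` (local matrix of a rational element)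
import HarnessLib

/-!
# h413 ∕ Track B «K2-LIT», line `K2_E4_SingularTransferKappaSign`, socket #2 `sig_K2E4ExplicitSplitConstantPhase` — KIT (part 1 of 3):
# the local images of the singular pair, non-negative orbital integrals, and the test function `𝟙_{K m K}` on `GL₃(L_w)`

Cell `pub/hodgecm-mathlib`, crux H413 = `stmt-HodgeConjecture-24833`; chair K2-lead (g0), dealer K2E4-plan (g0); seat K2E4-p02 (file #2 of «SKELETON LANDED K2E4», REQUESTS l.72384).
THEOREMS ONLY (no `def`, no `instance`, no `notation`, no named fact, no `sorry`); lane `--supports stmt-HodgeConjecture-24833` (count-neutral helper).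
Consumed by ★ `Theorems/K2E4ExplicitSplitConstantPhasePair` (part 2) and ★ `Theorems/K2E4ExplicitSplitConstantPhase` (part 3: socket #2 FROM socket #1 — the PHASE
`cv · Δ‴_v(γ_{H,v}, γ_{0,v}) > 0` of the split-place singular constant, read on the explicit transfer pair `(cmSplitTransfer f₀, f₀)` of [Rogawski1990, Lemma 4.13.1 (a)]).

* §1 at a place `v` with two places of `L` above it: a split witness `w̄ ≠ w` (`exists_smul_ne_of_not_subsingleton`); for the singular endoscopic element
  `γ_H = (e₁·1₂, e₂) ∈ H(L⁺)`: the `U(Φ₂)`-part of `γ_{H,v}` is `e₁·1` (`coe_fst_local_eq_smul_one`), `u = e₂ ⊗ 1` (`finGammaTwo_local_eq`),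
  `χ_g(u) = (e₂ − e₁)² ⊗ 1` is a unit (`eval_finCharpolyTwo_local_eq`, `isUnit_eval_finCharpolyTwo_local`) [Rogawski1990, §4.9 p. 55: `Δ_{G∕H} = τ D_{G∕H}` reads `χ_g(u)`].
* §1′ the orbital integral of a real non-negative test function against ANY orbital measure (family) is a non-negative real
  (`exists_orbitalIntegral_eq_ofReal_nonneg`, `exists_classOrbitalIntegral_eq_ofReal_nonneg`) [Rogawski1990, §4.1 (4.1.1)].
* §2 the double coset `K m K ⊂ GL₃(L_w)` (`K = GL₃(𝒪_w)`): contains `m`, is conjugation-`K`-invariant, compact, open; and the `K × U`-integral of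
  `𝟙_{K m K}(k (m u) k⁻¹)` against the normalised ★ `splitKUMeasure` is a POSITIVE real (`exists_integral_indicator_doubleCoset_eq_pos`: `= μ_U{u | m u ∈ K m K}`,
  an open relatively compact subset of `U`) [Rogawski1990, §4.13 p. 64, §4.4 p. 44]; `indicator_const_preimage_symm_apply` (transport of `𝟙` along `e′`).

HONEST LABEL.  HC_CM is proved only modulo the 7 printed citations (2 remaining named inputs: hLiu418 = `stmt-HodgeConjecture-24832`, h413 = `stmt-HodgeConjecture-24833`)
until rung 0 closes; this file is bookkeeping and moves no counter.

## References
* [Rogawski1990] J. D. Rogawski, *Automorphic Representations of Unitary Groups in Three Variables*, Ann. of Math. Stud. 123 (1990): §4.1 (4.1.1) p. 39, §4.4 p. 44,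
  §4.9 p. 55, §4.13 Lemma 4.13.1 (a) pp. 64–66.
* [PlatonovRapinchuk1994] V. Platonov, A. Rapinchuk, *Algebraic Groups and Number Theory* (1994), §5.1 (localisation of rational points).
-/

set_option autoImplicit false
-- the mandated namespace repeats the single-problem summit's segment (`HodgeConjecture.HodgeConjecture`)
set_option linter.dupNamespace false

noncomputable section

open MeasureTheory Measure NumberField IsDedekindDomain TopologicalSpace
open Literature.MeasureTheory.Group Literature.MeasureTheory.RestrictedProduct
open Literature.Topology.RestrictedProduct Literature.Topology.Algebra.RestrictedProduct
open Literature.NumberTheory.Rogawski1990 Literature.NumberTheory.Automorphic Literature.NumberTheory.GaloisRepresentations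
open Literature.AlgebraicGeometry.ShimuraVarieties (unitaryGroup hermForm)
open scoped Matrix MatrixGroups RestrictedProduct NNReal ENNReal

namespace Summit.HodgeConjecture.HodgeConjecture.Cruxes.H413.K2E4ExplicitSplitConstantPhase

/-! ## §1 Bookkeeping at a split place: the witness `w`, the local images of the singular pair, non-negative orbital integrals -/

section Bookkeeping

variable (L : Type) [Field L] [NumberField L] [IsCMField L]

/-- **A place of `L⁺` with two places of `L` above it has a split witness `w̄ ≠ w`** (contrapositive of ★ `PlacesOver.subsingleton_of_smul_eq`; the socket's guard
`¬ Subsingleton (PlacesOver L v)` in the shape ★ `splitWitness` ∕ ★ `isLocalDeltaTransfer_cmSplitTransfer` consume). [cite: Rogawski1990, §4.13 p. 64] -/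
theorem exists_smul_ne_of_not_subsingleton (v : HeightOneSpectrum (𝓞 ↥(maximalRealSubfield L))) (hv : ¬ Subsingleton (UnitaryGroup.PlacesOver L v)) :
    ∃ w : UnitaryGroup.PlacesOver L v, IsCMField.complexConj L • w.1 ≠ w.1 := by
  by_contra h
  simp only [ne_eq, not_exists, not_not] at h
  obtain ⟨w⟩ : Nonempty (UnitaryGroup.PlacesOver L v) := inferInstance
  exact hv (UnitaryGroup.PlacesOver.subsingleton_of_smul_eq (IsCMField.complexConj L) (IsCMField.complexConj_ne_one L) w (h w))

variable (v : HeightOneSpectrum (𝓞 ↥(maximalRealSubfield L)))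
  (γH : (UnitaryGroup.cmDatum L 2 (Matrix.of fun i j : Fin 2 => if i.val + j.val + 1 = 2 then (1 : L) else 0)).Rational ×
    (UnitaryGroup.cmDatum L 1 (Matrix.of fun i j : Fin 1 => if i.val + j.val + 1 = 1 then (1 : L) else 0)).Rational)
  {e₁ e₂ : L}

/-- **The `U(Φ₂)`-part of `γ_{H,v}` is the scalar `e₁·1`** (entrywise localisation of `γ_H.1 = e₁·1`, ★ `coe_toLocal_toAdelic_eq_map`). [cite: PlatonovRapinchuk1994, §5.1] -/
theorem coe_fst_local_eq_smul_one
    (h₁ : (((γH.1 : unitaryGroup (cmConjRingHom L) (Matrix.of fun i j : Fin 2 => if i.val + j.val + 1 = 2 then (1 : L) else 0)).val : GL (Fin 2) L) :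
        Matrix (Fin 2) (Fin 2) L) = e₁ • (1 : Matrix (Fin 2) (Fin 2) L)) :
    ((((UnitaryGroup.cmDatum L 2 (Matrix.of fun i j : Fin 2 => if i.val + j.val + 1 = 2 then (1 : L) else 0)).toLocal v
        ((UnitaryGroup.cmDatum L 2 (Matrix.of fun i j : Fin 2 => if i.val + j.val + 1 = 2 then (1 : L) else 0)).toAdelic γH.1)).val :
          GL (Fin 2) (UnitaryGroup.LocalRing L v)).val : Matrix (Fin 2) (Fin 2) (UnitaryGroup.LocalRing L v)) =
      algebraMap L (UnitaryGroup.LocalRing L v) e₁ • (1 : Matrix (Fin 2) (Fin 2) (UnitaryGroup.LocalRing L v)) := by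
  rw [coe_toLocal_toAdelic_eq_map, h₁, Matrix.map_smul' _ _ _ (map_mul _), Matrix.map_one _ (map_zero _) (map_one _)]

/-- **The `U(Φ₁)`-part of `γ_{H,v}` is `e₂`**: `u = finGammaTwo L v γ_{H,v} = e₂ ⊗ 1` (★ `finGammaTwo` is the `(0,0)` entry; ★ `coe_toLocal_toAdelic_eq_map`). [cite: Rogawski1990, §4.9 p. 55] -/
theorem finGammaTwo_local_eq
    (h₂ : (((γH.2 : unitaryGroup (cmConjRingHom L) (Matrix.of fun i j : Fin 1 => if i.val + j.val + 1 = 1 then (1 : L) else 0)).val : GL (Fin 1) L) :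
        Matrix (Fin 1) (Fin 1) L) 0 0 = e₂) :
    finGammaTwo L v
        ((UnitaryGroup.cmDatum L 2 (Matrix.of fun i j : Fin 2 => if i.val + j.val + 1 = 2 then (1 : L) else 0)).toLocal v
            ((UnitaryGroup.cmDatum L 2 (Matrix.of fun i j : Fin 2 => if i.val + j.val + 1 = 2 then (1 : L) else 0)).toAdelic γH.1),
          (UnitaryGroup.cmDatum L 1 (Matrix.of fun i j : Fin 1 => if i.val + j.val + 1 = 1 then (1 : L) else 0)).toLocal v
            ((UnitaryGroup.cmDatum L 1 (Matrix.of fun i j : Fin 1 => if i.val + j.val + 1 = 1 then (1 : L) else 0)).toAdelic γH.2)) =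
      algebraMap L (UnitaryGroup.LocalRing L v) e₂ := by
  unfold finGammaTwo
  rw [coe_toLocal_toAdelic_eq_map, Matrix.map_apply, h₂]

/-- **`χ_g(u) = (e₂ − e₁)² ⊗ 1` at the singular pair** (`g = e₁·1₂`: `charpoly = (X − e₁)²`, Mathlib `Matrix.charpoly_diagonal`). [cite: Rogawski1990, §4.9 p. 55] -/
theorem eval_finCharpolyTwo_local_eq
    (h₁ : (((γH.1 : unitaryGroup (cmConjRingHom L) (Matrix.of fun i j : Fin 2 => if i.val + j.val + 1 = 2 then (1 : L) else 0)).val : GL (Fin 2) L) :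
        Matrix (Fin 2) (Fin 2) L) = e₁ • (1 : Matrix (Fin 2) (Fin 2) L))
    (h₂ : (((γH.2 : unitaryGroup (cmConjRingHom L) (Matrix.of fun i j : Fin 1 => if i.val + j.val + 1 = 1 then (1 : L) else 0)).val : GL (Fin 1) L) :
        Matrix (Fin 1) (Fin 1) L) 0 0 = e₂) :
    (finCharpolyTwo L v
        ((UnitaryGroup.cmDatum L 2 (Matrix.of fun i j : Fin 2 => if i.val + j.val + 1 = 2 then (1 : L) else 0)).toLocal v
            ((UnitaryGroup.cmDatum L 2 (Matrix.of fun i j : Fin 2 => if i.val + j.val + 1 = 2 then (1 : L) else 0)).toAdelic γH.1),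
          (UnitaryGroup.cmDatum L 1 (Matrix.of fun i j : Fin 1 => if i.val + j.val + 1 = 1 then (1 : L) else 0)).toLocal v
            ((UnitaryGroup.cmDatum L 1 (Matrix.of fun i j : Fin 1 => if i.val + j.val + 1 = 1 then (1 : L) else 0)).toAdelic γH.2))).eval
      (finGammaTwo L v
        ((UnitaryGroup.cmDatum L 2 (Matrix.of fun i j : Fin 2 => if i.val + j.val + 1 = 2 then (1 : L) else 0)).toLocal v
            ((UnitaryGroup.cmDatum L 2 (Matrix.of fun i j : Fin 2 => if i.val + j.val + 1 = 2 then (1 : L) else 0)).toAdelic γH.1),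
          (UnitaryGroup.cmDatum L 1 (Matrix.of fun i j : Fin 1 => if i.val + j.val + 1 = 1 then (1 : L) else 0)).toLocal v
            ((UnitaryGroup.cmDatum L 1 (Matrix.of fun i j : Fin 1 => if i.val + j.val + 1 = 1 then (1 : L) else 0)).toAdelic γH.2))) =
      algebraMap L (UnitaryGroup.LocalRing L v) ((e₂ - e₁) ^ 2) := by
  unfold finCharpolyTwo
  rw [finGammaTwo_local_eq L v γH h₂]
  -- `finCharpolyTwo` reads the first component of the pair
  show (((((UnitaryGroup.cmDatum L 2 (Matrix.of fun i j : Fin 2 => if i.val + j.val + 1 = 2 then (1 : L) else 0)).toLocal v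
        ((UnitaryGroup.cmDatum L 2 (Matrix.of fun i j : Fin 2 => if i.val + j.val + 1 = 2 then (1 : L) else 0)).toAdelic γH.1)).val :
          GL (Fin 2) (UnitaryGroup.LocalRing L v)).val : Matrix (Fin 2) (Fin 2) (UnitaryGroup.LocalRing L v)).charpoly).eval
      (algebraMap L (UnitaryGroup.LocalRing L v) e₂) = _
  rw [coe_fst_local_eq_smul_one L v γH h₁, Matrix.smul_one_eq_diagonal, Matrix.charpoly_diagonal]
  simp only [Finset.prod_const, Finset.card_univ, Fintype.card_fin, Polynomial.eval_pow, Polynomial.eval_sub, Polynomial.eval_X,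
    Polynomial.eval_C, map_pow, map_sub]

/-- **`χ_g(u)` is a unit at the singular pair** (`e₁ ≠ e₂` in the field `L`, and `L → L ⊗ L⁺_v` is a ring homomorphism) — the `hu` input of ★
`finExplicitDelta_eq_tau_mul_weyl_of_split` ∕ ★ `finTau_eq_localComponent_det_of_split`. [cite: Rogawski1990, §4.9 p. 55] -/
theorem isUnit_eval_finCharpolyTwo_local (hne : e₁ ≠ e₂)
    (h₁ : (((γH.1 : unitaryGroup (cmConjRingHom L) (Matrix.of fun i j : Fin 2 => if i.val + j.val + 1 = 2 then (1 : L) else 0)).val : GL (Fin 2) L) :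
        Matrix (Fin 2) (Fin 2) L) = e₁ • (1 : Matrix (Fin 2) (Fin 2) L))
    (h₂ : (((γH.2 : unitaryGroup (cmConjRingHom L) (Matrix.of fun i j : Fin 1 => if i.val + j.val + 1 = 1 then (1 : L) else 0)).val : GL (Fin 1) L) :
        Matrix (Fin 1) (Fin 1) L) 0 0 = e₂) :
    IsUnit ((finCharpolyTwo L v
        ((UnitaryGroup.cmDatum L 2 (Matrix.of fun i j : Fin 2 => if i.val + j.val + 1 = 2 then (1 : L) else 0)).toLocal v
            ((UnitaryGroup.cmDatum L 2 (Matrix.of fun i j : Fin 2 => if i.val + j.val + 1 = 2 then (1 : L) else 0)).toAdelic γH.1),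
          (UnitaryGroup.cmDatum L 1 (Matrix.of fun i j : Fin 1 => if i.val + j.val + 1 = 1 then (1 : L) else 0)).toLocal v
            ((UnitaryGroup.cmDatum L 1 (Matrix.of fun i j : Fin 1 => if i.val + j.val + 1 = 1 then (1 : L) else 0)).toAdelic γH.2))).eval
      (finGammaTwo L v
        ((UnitaryGroup.cmDatum L 2 (Matrix.of fun i j : Fin 2 => if i.val + j.val + 1 = 2 then (1 : L) else 0)).toLocal v
            ((UnitaryGroup.cmDatum L 2 (Matrix.of fun i j : Fin 2 => if i.val + j.val + 1 = 2 then (1 : L) else 0)).toAdelic γH.1),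
          (UnitaryGroup.cmDatum L 1 (Matrix.of fun i j : Fin 1 => if i.val + j.val + 1 = 1 then (1 : L) else 0)).toLocal v
            ((UnitaryGroup.cmDatum L 1 (Matrix.of fun i j : Fin 1 => if i.val + j.val + 1 = 1 then (1 : L) else 0)).toAdelic γH.2)))) := by
  rw [eval_finCharpolyTwo_local_eq L v γH h₁ h₂]
  exact ((IsUnit.mk0 _ (sub_ne_zero.mpr hne.symm)).pow 2).map _

end Bookkeeping

/-! ### Non-negative test functions have non-negative (local stable) orbital integrals -/

section Nonneg

variable {G : Type*} [Group G] [∀ γ : G, MeasurableSpace (G ⧸ Subgroup.centralizer ({γ} : Set G))]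

/-- **The orbital integral of a real non-negative function is a non-negative real** (as a complex number): for `f = (r : G → ℝ≥0) ↪ ℂ`,
`Φ(γ, f) = ∫ r(y γ y⁻¹) ≥ 0` for EVERY measure on `G ⧸ G_γ` (Bochner: `integral_ofReal`, `integral_nonneg`; a non-integrable integrand gives `0`).
[cite: Rogawski1990, §4.1 (4.1.1) p. 39] -/
theorem exists_orbitalIntegral_eq_ofReal_nonneg (γ : G) (m : Measure (G ⧸ Subgroup.centralizer ({γ} : Set G))) (r : G → ℝ) (hr : ∀ g, 0 ≤ r g) :
    ∃ s : ℝ, 0 ≤ s ∧ orbitalIntegral γ (fun g => ((r g : ℝ) : ℂ)) m = (s : ℂ) := by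
  refine ⟨∫ y, descConj γ (Subgroup.centralizer ({γ} : Set G)) (fun _ hg => Subgroup.mem_centralizer_singleton_iff.1 hg) r y ∂m,
    integral_nonneg fun y => ?_, ?_⟩
  · induction y using QuotientGroup.induction_on
    exact hr _
  · rw [orbitalIntegral_eq_integral_descConj, ← integral_complex_ofReal]
    congr 1
    funext y
    induction y using QuotientGroup.induction_on
    rfl

/-- The class version: `Φ([γ], f) ≥ 0` for a non-negative real `f` and ANY orbital measure family. [cite: Rogawski1990, §4.1 (4.1.1) p. 39] -/
theorem exists_classOrbitalIntegral_eq_ofReal_nonneg (mfam : OrbitalMeasureFamily G) (r : G → ℝ) (hr : ∀ g, 0 ≤ r g) (c : ConjClasses G) :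
    ∃ s : ℝ, 0 ≤ s ∧ classOrbitalIntegral mfam (fun g => ((r g : ℝ) : ℂ)) c = (s : ℂ) :=
  exists_orbitalIntegral_eq_ofReal_nonneg (Quotient.out c) (mfam c) r hr

end Nonneg


/-! ## §2 The test function `𝟙_{K m K}` on `GL₃(L_w)` and the positivity of its `K × U`-integral -/

section DoubleCoset

variable {L : Type} [Field L] [NumberField L] (w : HeightOneSpectrum (𝓞 L)) (m : GL (Fin 3) (w.adicCompletion L))

/-- `m ∈ K m K`. [cite: Rogawski1990, §4.4 p. 44] -/
theorem mem_doubleCoset_self :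
    m ∈ Set.image2 (fun a b : GL (Fin 3) (w.adicCompletion L) => a * m * b) ↑(glInt 3 (w.adicCompletion L)) ↑(glInt 3 (w.adicCompletion L)) := by
  have h := Set.mem_image2_of_mem (f := fun a b : GL (Fin 3) (w.adicCompletion L) => a * m * b)
    (glInt 3 (w.adicCompletion L)).one_mem (glInt 3 (w.adicCompletion L)).one_mem
  simpa only [one_mul, mul_one] using h

/-- `K m K` is invariant under conjugation by `K = GL₃(𝒪_w)`: `k x k⁻¹ ∈ K m K ↔ x ∈ K m K`. [cite: Rogawski1990, §4.4 p. 44] -/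
theorem conj_mem_doubleCoset_iff {k : GL (Fin 3) (w.adicCompletion L)} (hk : k ∈ glInt 3 (w.adicCompletion L)) (x : GL (Fin 3) (w.adicCompletion L)) :
    k * x * k⁻¹ ∈ Set.image2 (fun a b : GL (Fin 3) (w.adicCompletion L) => a * m * b) ↑(glInt 3 (w.adicCompletion L)) ↑(glInt 3 (w.adicCompletion L)) ↔
      x ∈ Set.image2 (fun a b : GL (Fin 3) (w.adicCompletion L) => a * m * b) ↑(glInt 3 (w.adicCompletion L)) ↑(glInt 3 (w.adicCompletion L)) := by
  constructor
  · rintro ⟨a, ha, b, hb, hab⟩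
    refine ⟨k⁻¹ * a, (glInt 3 _).mul_mem ((glInt 3 _).inv_mem hk) ha, b * k, (glInt 3 _).mul_mem hb hk, ?_⟩
    have : x = k⁻¹ * (k * x * k⁻¹) * k := by group
    rw [this, ← hab]
    group
  · rintro ⟨a, ha, b, hb, hab⟩
    refine ⟨k * a, (glInt 3 _).mul_mem hk ha, b * k⁻¹, (glInt 3 _).mul_mem hb ((glInt 3 _).inv_mem hk), ?_⟩
    rw [← hab]
    group

/-- `K m K` is compact (continuous image of `K × K`). [cite: Rogawski1990, §4.4 p. 44] -/
theorem isCompact_doubleCoset :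
    IsCompact (Set.image2 (fun a b : GL (Fin 3) (w.adicCompletion L) => a * m * b) ↑(glInt 3 (w.adicCompletion L)) ↑(glInt 3 (w.adicCompletion L))) := by
  rw [← Set.image_prod]
  exact ((isCompact_glInt 3 (w.adicCompletion L)).prod (isCompact_glInt 3 (w.adicCompletion L))).image
    ((continuous_fst.mul continuous_const).mul continuous_snd)

/-- `K m K` is open (a union of left translates of the open subgroup `K`). [cite: Rogawski1990, §4.4 p. 44] -/
theorem isOpen_doubleCoset :
    IsOpen (Set.image2 (fun a b : GL (Fin 3) (w.adicCompletion L) => a * m * b) ↑(glInt 3 (w.adicCompletion L)) ↑(glInt 3 (w.adicCompletion L))) := by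
  rw [← Set.iUnion_image_left]
  refine isOpen_biUnion fun a _ => ?_
  exact (isOpenMap_mul_left (a * m)) _ (isOpen_glInt 3 (w.adicCompletion L))

/-- **The `K × U`-integral of `𝟙_{K m K}` along the conjugated unipotent fibre at `m` is a POSITIVE REAL**: with the normalised measure `κ ⊗ μ_U` of ★
`UnitaryGroup.splitKUMeasure` (`κ(K) = 1`), `∫_{K × U} 𝟙_{K m K}(k (m u) k⁻¹) = μ_U{u ∈ U | m u ∈ K m K} ∈ (0, ∞)` — the integrand does not depend on `k` (bi-`K`-invariance), and
`{u | m u ∈ K m K}` is an OPEN (it contains `1`) RELATIVELY COMPACT (inside `U ∩ m⁻¹ K m K`) subset of the closed subgroup `U`. [cite: Rogawski1990, §4.13 Lemma 4.13.1 (a) p. 64; §4.4 p. 44] -/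
theorem exists_integral_indicator_doubleCoset_eq_pos :
    letI : MeasurableSpace (GL (Fin 3) (w.adicCompletion L)) := borel _
    ∃ r : ℝ, 0 < r ∧ (∫ q : ↥(glInt 3 (w.adicCompletion L)) × ↥(unipotentRadicalGL (w.adicCompletion L) (Zelevinsky1980.lastBlockLabel 3)),
        (Set.image2 (fun a b : GL (Fin 3) (w.adicCompletion L) => a * m * b) ↑(glInt 3 (w.adicCompletion L)) ↑(glInt 3 (w.adicCompletion L))).indicator
          (fun _ => (1 : ℂ)) ((q.1 : GL (Fin 3) (w.adicCompletion L)) * (m * (q.2 : GL (Fin 3) (w.adicCompletion L))) * (q.1 : GL (Fin 3) (w.adicCompletion L))⁻¹)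
          ∂(UnitaryGroup.splitKUMeasure (w.adicCompletion L))) = (r : ℂ) := by
  letI : MeasurableSpace (GL (Fin 3) (w.adicCompletion L)) := borel _
  haveI : BorelSpace (GL (Fin 3) (w.adicCompletion L)) := ⟨rfl⟩
  haveI : LocallyCompactSpace (GL (Fin 3) (w.adicCompletion L)) := UnitaryGroup.locallyCompactSpace_gl_adicCompletion L 3 w
  haveI : SecondCountableTopology (GL (Fin 3) (w.adicCompletion L)) := UnitaryGroup.secondCountableTopology_gl_adicCompletion L 3 w
  have hUc : IsClosed ((unipotentRadicalGL (w.adicCompletion L) (Zelevinsky1980.lastBlockLabel 3) : Subgroup (GL (Fin 3) (w.adicCompletion L))) :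
      Set (GL (Fin 3) (w.adicCompletion L))) :=
    isClosed_unipotentRadicalGL (R := w.adicCompletion L) (Zelevinsky1980.lastBlockLabel 3)
  haveI : CompactSpace ↥(glInt 3 (w.adicCompletion L)) := isCompact_iff_compactSpace.1 (isCompact_glInt 3 (w.adicCompletion L))
  haveI : BorelSpace ↥(glInt 3 (w.adicCompletion L)) := Subtype.borelSpace _
  haveI : BorelSpace ↥(unipotentRadicalGL (w.adicCompletion L) (Zelevinsky1980.lastBlockLabel 3)) := Subtype.borelSpace _
  haveI : LocallyCompactSpace ↥(unipotentRadicalGL (w.adicCompletion L) (Zelevinsky1980.lastBlockLabel 3)) :=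
    hUc.isClosedEmbedding_subtypeVal.locallyCompactSpace
  haveI : SecondCountableTopology ↥(unipotentRadicalGL (w.adicCompletion L) (Zelevinsky1980.lastBlockLabel 3)) :=
    TopologicalSpace.Subtype.secondCountableTopology _
  -- the two normalised Haar measures, kept opaque
  obtain ⟨κ, hκ⟩ : ∃ κ : Measure ↥(glInt 3 (w.adicCompletion L)), κ = haarMeasure (UnitaryGroup.glIntPositiveCompacts (w.adicCompletion L)) := ⟨_, rfl⟩
  obtain ⟨μU, hμU⟩ : ∃ μU : Measure ↥(unipotentRadicalGL (w.adicCompletion L) (Zelevinsky1980.lastBlockLabel 3)),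
      μU = haarMeasure (UnitaryGroup.unipotentIntPositiveCompacts (w.adicCompletion L)) := ⟨_, rfl⟩
  haveI : IsHaarMeasure κ := by rw [hκ]; exact isHaarMeasure_haarMeasure _
  haveI : IsHaarMeasure μU := by rw [hμU]; exact isHaarMeasure_haarMeasure _
  have hκ1 : κ Set.univ = 1 := by rw [hκ]; exact haarMeasure_self
  have hKU : UnitaryGroup.splitKUMeasure (w.adicCompletion L) = κ.prod μU := by rw [hκ, hμU]; rfl
  -- the set `T = {u ∈ U | m u ∈ K m K}`
  set C : Set (GL (Fin 3) (w.adicCompletion L)) :=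
    Set.image2 (fun a b : GL (Fin 3) (w.adicCompletion L) => a * m * b) ↑(glInt 3 (w.adicCompletion L)) ↑(glInt 3 (w.adicCompletion L)) with hC
  set T : Set ↥(unipotentRadicalGL (w.adicCompletion L) (Zelevinsky1980.lastBlockLabel 3)) :=
    {u | m * (u : GL (Fin 3) (w.adicCompletion L)) ∈ C} with hT
  have hTo : IsOpen T := (isOpen_doubleCoset w m).preimage (continuous_const.mul continuous_subtype_val)
  have h1T : (1 : ↥(unipotentRadicalGL (w.adicCompletion L) (Zelevinsky1980.lastBlockLabel 3))) ∈ T := by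
    show m * ((1 : ↥(unipotentRadicalGL (w.adicCompletion L) (Zelevinsky1980.lastBlockLabel 3))) : GL (Fin 3) (w.adicCompletion L)) ∈ C
    rw [OneMemClass.coe_one, mul_one]
    exact mem_doubleCoset_self w m
  have hT0 : μU T ≠ 0 := (hTo.measure_pos μU ⟨1, h1T⟩).ne'
  have hTt : μU T ≠ ⊤ := by
    have hsub : T ⊆ ((↑) : ↥(unipotentRadicalGL (w.adicCompletion L) (Zelevinsky1980.lastBlockLabel 3)) → GL (Fin 3) (w.adicCompletion L)) ⁻¹'
        ((fun x => m⁻¹ * x) '' C) := by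
      intro u hu
      exact ⟨m * (u : GL (Fin 3) (w.adicCompletion L)), hu, by simp only [inv_mul_cancel_left]⟩
    have hcpt : IsCompact (((↑) : ↥(unipotentRadicalGL (w.adicCompletion L) (Zelevinsky1980.lastBlockLabel 3)) → GL (Fin 3) (w.adicCompletion L)) ⁻¹'
        ((fun x => m⁻¹ * x) '' C)) :=
      hUc.isClosedEmbedding_subtypeVal.isCompact_preimage ((isCompact_doubleCoset w m).image (continuous_const.mul continuous_id))
    exact ((measure_mono hsub).trans_lt hcpt.measure_lt_top).ne
  -- the integrand is the indicator of `K × T`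
  have hind : (fun q : ↥(glInt 3 (w.adicCompletion L)) × ↥(unipotentRadicalGL (w.adicCompletion L) (Zelevinsky1980.lastBlockLabel 3)) =>
      C.indicator (fun _ => (1 : ℂ)) ((q.1 : GL (Fin 3) (w.adicCompletion L)) * (m * (q.2 : GL (Fin 3) (w.adicCompletion L))) * (q.1 : GL (Fin 3) (w.adicCompletion L))⁻¹)) =
      (Set.univ ×ˢ T).indicator fun _ => (1 : ℂ) := by
    funext q
    by_cases hq : m * (q.2 : GL (Fin 3) (w.adicCompletion L)) ∈ C
    · have h1 : (q.1 : GL (Fin 3) (w.adicCompletion L)) * (m * (q.2 : GL (Fin 3) (w.adicCompletion L))) * (q.1 : GL (Fin 3) (w.adicCompletion L))⁻¹ ∈ C :=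
        (conj_mem_doubleCoset_iff w m q.1.2 _).2 hq
      have h2 : q ∈ Set.univ ×ˢ T := ⟨trivial, hq⟩
      rw [Set.indicator_of_mem h1, Set.indicator_of_mem h2]
    · have h1 : (q.1 : GL (Fin 3) (w.adicCompletion L)) * (m * (q.2 : GL (Fin 3) (w.adicCompletion L))) * (q.1 : GL (Fin 3) (w.adicCompletion L))⁻¹ ∉ C :=
        fun h => hq ((conj_mem_doubleCoset_iff w m q.1.2 _).1 h)
      have h2 : q ∉ Set.univ ×ˢ T := fun h => hq h.2
      rw [Set.indicator_of_notMem h1, Set.indicator_of_notMem h2]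
  refine ⟨(μU T).toReal, ENNReal.toReal_pos hT0 hTt, ?_⟩
  rw [hind, integral_indicator_const _ (MeasurableSet.univ.prod hTo.measurableSet), hKU, measureReal_def, Measure.prod_prod, hκ1, one_mul,
    Complex.real_smul, mul_one]

end DoubleCoset


/-! ### The constant term of `𝟙_{e′⁻¹(K m K)}` at `h` (with `m = m_h`) is a positive real; the test function is smooth and non-negative -/

/-- Transport of a constant indicator along a topological group isomorphism: `𝟙_{e⁻¹(s)}(e⁻¹ y) = 𝟙_s(y)`. [folklore] -/
theorem indicator_const_preimage_symm_apply {G G' M : Type*} [Mul G] [Mul G'] [TopologicalSpace G] [TopologicalSpace G'] [Zero M]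
    (e : G ≃ₜ* G') (s : Set G') (c : M) (y : G') :
    (⇑e ⁻¹' s).indicator (fun _ => c) (e.symm y) = s.indicator (fun _ => c) y := by
  by_cases hy : y ∈ s
  · have hy' : e.symm y ∈ ⇑e ⁻¹' s := by rw [Set.mem_preimage, ContinuousMulEquiv.apply_symm_apply]; exact hy
    rw [Set.indicator_of_mem hy, Set.indicator_of_mem hy']
  · have hy' : e.symm y ∉ ⇑e ⁻¹' s := fun h => hy (by rwa [Set.mem_preimage, ContinuousMulEquiv.apply_symm_apply] at h)
    rw [Set.indicator_of_notMem hy, Set.indicator_of_notMem hy']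
end Summit.HodgeConjecture.HodgeConjecture.Cruxes.H413.K2E4ExplicitSplitConstantPhase

end
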